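import Summits.ResolutionOfSingularities.ResolutionOfSingularities.Theorems.TameQuotientLU
import Summits.ResolutionOfSingularities.ResolutionOfSingularities.Theorems.LogCanQuotLU.Negative.Transport
import Literature.AlgebraicGeometry.Resolution.TameCyclicToricDescentModels
import Literature.AlgebraicGeometry.Resolution.ExcellentRingsFieldProofs
import Literature.AlgebraicGeometry.Resolution.AffineModelLU
import Mathlib.Algebra.Ring.GeomSum
import HarnessLib

/-!
# TameInertialLU — the TAME-INERTIAL LAW: totally tamely ramified cyclic tops with `μ_ℓ ⊆ K`, for EVERY residue
field algebraic over `k` (g28, lens 1, second door; annex to the node `InertDescentLU`)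

**Node g28-B of the ROOT/RESIDUAL decomposition cell `decomp-res`, lens 1 («grading / quantitative ladder»), window
(W-α) of critic row 207, CHEAP HALF (α1).**  Problem side, sorry-free, HYPOTHESIS-FREE (no `def : Prop` fact binder).

## Thesis
g25/g26 consumed Cossart–Piltant's tame descent [CossartPiltant2008, Lemma 9.4; CossartPiltant2019, Prop. 4.10]
only for places with residues IN `k` and `ζ_ℓ ∈ k` — the Literature brick
`exists_fixed_model_isRegularLocalRing` (`Literature/…/TameCyclicToricDescentModels.lean`) was fed with `S = k`
as the `σ`-fixed subfield carrying the residues and the roots of unity.  This node re-reads the brick's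
hypotheses (INVENTORY, `TameQuotientLU.lean` :206–222): the brick does NOT want `κ(O′) = S`; it wants (hres) the
generator RESIDUALLY TRIVIAL on `O′`, (halg) residues algebraic over the base FIELD `k`, and the units
`ζ, (ζ^j − 1)⁻¹ (0 < j < ℓ)` inside a `σ`-FIXED SUBRING `S ⊆ O′` containing the model.  So the residue clause of
g25's cell is an artefact of the choice `S = k`: THE LAW `relLU_of_tameInertialLUAbove : TameInertialLUAbove k O →
RelLocalUniformization k K O` is proved for the cell with «`ζ : k`» replaced by «`ζ : K`» and «residues in `k`»
replaced by «`σ ∈` inertia ∧ `κ(O′) | k` algebraic», by taking `S :=` the image of the ENLARGED model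
`R₁ = k[s₀ ∪ {ζ} ∪ {(ζ^j − 1)⁻¹ : 0 < j < ℓ}] ⊆ O` — the new elements are UNITS of `O` because `v(ℓ) = 0` separates
the `ℓ`-th roots of unity (`valuation_sub_one_eq_one`: `∏_{0<j<ℓ} (1 − ζ^j) = ℓ`) — then g25's pull-back /
transport verbatim.  KIND CONSUMED: cyclic `G = G_T`, `|G| ∣ ℓ ∈ k×`, `μ_ℓ ⊆ K`, ANY residue field (g25: `κ = k`).
g25's cell is a SUB-cell (`tameInertialLUAbove_of_tameEquivariantLUAbove`: residues in `k` ⇒ `σ ȳ = ȳ`).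

## The law, the residual, the cuts, the root (parts G–H)
* `relLU_of_tameInertialLUAbove` (part G), with the helper `valuation_sub_one_eq_one` (the node's `isFractionRing_of_le` is cited from the landed
`LogCanQuotLU.Negative.isFractionRing_of_le`, gate dedup).
* R29 `NonKHToricArchLUKeyHenselDescentQuotTInert e c n` (part H) := R28's binders ∧ `¬ TameInertialLUAbove`
  (`¬ TameInertial ⇒ ¬ TameEquivariant`); exact cuts `R28 ↔ R29`, `R25 ↔ R29`, `R23 ↔ R29`, `NonKHToricArchLU ↔ R29`;
  the decided piece `…QuotTInertCell` (`_holds`); `closes_tinert` = ROOT BY NAME modulo (CP floor, CJS, Π₁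
  `KK05NCVAscent`, `∀ d ≥ 4, R29 3 3 d`, 0642 `Valuative.PatchingRel`); `root_iff_tinert_sigma`.
* HONEST LOCATED REMAINDER (R29 docstring): (α2) `μ_ℓ ⊄ K` — the brick's `σ`-fixed output then lives over
  `K(ζ_ℓ)`, and coming down the cyclotomic étale layer is INPUT PRODUCTION for (K-L3) restricted to `K(ζ_ℓ) | K`
  — NOT consumed, NOT claimed; non-cyclic tame `G_T`; (β) wild; (γ) defect.

## Paper instance (NODE-g28-B.md §5): `k = 𝔽_p`, `K = 𝔽_p(x, y)`, the rank-1 non-Abhyankar place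
`x ↦ t`, `y ↦ α t + t² ξ(t)` into `𝔽_{p²}((t))` (`α ∈ 𝔽_{p²} ∖ 𝔽_p`, `ξ` transcendental), `κ(O) = 𝔽_{p²} ≠ k`;
`ℓ ∣ p − 1`, `ζ_ℓ ∈ 𝔽_p ⊆ K`; Kummer top `K′ = K(x^{1/ℓ})`, `e = ℓ`, `G = G_T = ℤ/ℓ`: g25's residue clause FAILS at
`y/x` (residue `α ∉ k`), the tame-inertial cell HOLDS.

Sources: [cite: CossartPiltant2008, Lemma 9.4 (HAL pp. 28–30)] · [cite: CossartPiltant2019, Prop. 4.10] ·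
[cite: KnafKuhlmann2005, Thm. 1.1] (the ascent Π₁ named in `closes_tinert`) · [cite: ZariskiSamuel1960II, Ch. VI
§12 (ramification theory of valuations: `G_T`, `G_Z`)].
-/

noncomputable section

open IntermediateField Polynomial Literature.AlgebraicGeometry.Resolution
open Summit.ResolutionOfSingularities.ResolutionOfSingularities.Theorems.TameQuotientLU

namespace Summit.ResolutionOfSingularities.ResolutionOfSingularities.Theorems.TameInertialLU

/-! ## PART G — the TAME-INERTIAL CELL of a place `(K, O)` over `k` and THE LAW
(slice `TameInertialLU`: cell, sub-cell, units; law) -/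

section LawT

variable (k : Type) [Field k] {K : Type} [Field K] [Algebra k K]

/-- **The TAME-INERTIAL CELL of a place `(K, O)` over `k`** (TYPED): g25's tame-quotient cell
`TameQuotientLU.TameEquivariantLUAbove` with exactly two clauses changed — the primitive `ℓ`-th root of unity is
asked IN `K` (not in `k`), and «residues in `k`» is replaced by «`σ` acts trivially on the residue field of `O′`
(`σ` lies in the INERTIA group) and the residues of `O′` are algebraic over `k`».  So: a finite CYCLIC Galois top
`K′ | K` with generator `σ`, `σ ^ ℓ = 1`, `ℓ ∈ k×`, `μ_ℓ ⊆ K`, a valuation ring `O′` above `O` fixed by `σ` on which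
`σ` is residually trivial, `κ(O′) | k` algebraic, and `σ`-EQUIVARIANT relative local uniformization upstairs over
the models of `K`.  Generic inhabitants: totally tamely ramified cyclic (Kummer) tops `K′ = K(θ)`, `θ^ℓ ∈ K`,
`G = G_T`, over places whose residue field is ANY algebraic extension of `k`.
THE TWO DIFFS against g25's VERBATIM cell (`TameQuotientLU.lean` :71), printed:
* (D1) `∃ ζ : k, IsPrimitiveRoot ζ ℓ ∧`  ↦  `∃ ζ : K, IsPrimitiveRoot ζ ℓ ∧`  (`μ_ℓ ⊆ K` instead of `μ_ℓ ⊆ k`);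
* (D2) `(∀ y ∈ O', ∃ c : k, y - algebraMap k K' c ∈ O'.nonunits) ∧`  ↦
  `(∀ y ∈ O', O'.valuation (σ y - y) < 1) ∧ (∀ y ∈ O', ∃ f : Polynomial k, f ≠ 0 ∧ Polynomial.aeval y f ∈ O'.nonunits) ∧`
  («residues in `k`» replaced by «`σ` residually trivial on `O′` ∧ residues of `O′` algebraic over `k`»).
Every other clause is byte-identical; `ℓ` is ANY positive integer invertible in `k` (composite allowed). (Sources:
CossartPiltant2008, Lemma 9.4; CossartPiltant2019, Prop. 4.10.) -/
def TameInertialLUAbove (O : ValuationSubring K) : Prop :=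
  ∃ K' : IntermediateField K (AlgebraicClosure K), FiniteDimensional K K' ∧ IsGalois K K' ∧
  ∃ σ : K' ≃ₐ[K] K', (∀ g : K' ≃ₐ[K] K', ∃ i : ℕ, g = σ ^ i) ∧
  ∃ ℓ : ℕ, 0 < ℓ ∧ (ℓ : k) ≠ 0 ∧ σ ^ ℓ = 1 ∧
  ∃ ζ : K, IsPrimitiveRoot ζ ℓ ∧
  ∃ O' : ValuationSubring K', O'.comap (algebraMap K K') = O ∧ (∀ y : K', y ∈ O' ↔ σ y ∈ O') ∧
    (∀ y ∈ O', O'.valuation (σ y - y) < 1) ∧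
    (∀ y ∈ O', ∃ f : Polynomial k, f ≠ 0 ∧ Polynomial.aeval y f ∈ O'.nonunits) ∧
  ∀ R : Subalgebra k K, R.FG → IsFractionRing R K → R.toSubring ≤ O.toSubring →
    ∃ t₀ : Finset K', modelAbove k R K' t₀ ≤ O'.toSubring ∧
      (∀ y ∈ modelAbove k R K' t₀, σ y ∈ modelAbove k R K' t₀) ∧
      IsRegularLocalRing (locAtCentre (modelAbove k R K' t₀) O')

variable {k}

/-- g25's tame-quotient cell is a SUB-CELL of the tame-inertial cell: residues in `k` make `σ` residually
trivial (`σ` fixes `k`) and the residues algebraic over `k` (linear polynomials `X - c`); `ζ ∈ k ⊆ K`.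
[folklore] -/
theorem tameInertialLUAbove_of_tameEquivariantLUAbove {O : ValuationSubring K}
    (h : TameEquivariantLUAbove k O) : TameInertialLUAbove k O := by
  obtain ⟨K', hfin, hgal, σ, hcyc, ℓ, hℓ, hℓk, hσℓ, ζ, hζ, O', hO'O, hσO', hκ', hLU⟩ := h
  have hfk : ∀ c : k, algebraMap K K' (algebraMap k K c) = algebraMap k K' c := fun c =>
    (IsScalarTower.algebraMap_apply k K K' c).symm
  have hσk : ∀ c : k, σ (algebraMap k K' c) = algebraMap k K' c := fun c => by
    rw [← hfk]
    exact σ.commutes _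
  refine ⟨K', hfin, hgal, σ, hcyc, ℓ, hℓ, hℓk, hσℓ, algebraMap k K ζ,
    hζ.map_of_injective (algebraMap k K).injective, O', hO'O, hσO', ?_, ?_, hLU⟩
  · intro y hy
    obtain ⟨c, hc⟩ := hκ' y hy
    have h1 : O'.valuation (y - algebraMap k K' c) < 1 := (O'.mem_nonunits_iff).mp hc
    have h2 : O'.valuation (σ (y - algebraMap k K' c)) < 1 := valuation_map_lt_one_of_stable hσO' h1
    have h3 : σ y - y = σ (y - algebraMap k K' c) - (y - algebraMap k K' c) := by
      rw [map_sub, hσk]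
      ring
    rw [h3]
    exact lt_of_le_of_lt (Valuation.map_sub _ _ _) (max_lt h2 h1)
  · intro y hy
    obtain ⟨c, hc⟩ := hκ' y hy
    refine ⟨X - C c, X_sub_C_ne_zero c, ?_⟩
    rwa [map_sub, aeval_X, aeval_C]

/-! Writer g13 (gate dedup, pre-flight of the first proposal): the node's helper `isFractionRing_of_le` restates the LANDED
`LogCanQuotLU.Negative.isFractionRing_of_le` (`Theorems/LogCanQuotLU/Negative/Transport.lean`, same binder shapes); the copy is deleted
and its one use in `relLU_of_tameInertialLUAbove` cites the landed declaration (import added; that module sits in the same import cone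
as `TameQuotientLU`). No other declaration text changed. -/

/-- **Roots of unity of order prime to the residue characteristic are residually distinct**: if `ℓ` is a
unit of the valuation ring `O` and `η ∈ O`, `η ^ ℓ = 1`, `η ≠ 1`, then `η - 1` is a unit of `O`
(`ℓ = ∑ (1 - η^i)` would otherwise have positive value). [folklore] -/
theorem valuation_sub_one_eq_one (O : ValuationSubring K) {ℓ : ℕ} (hvℓ : O.valuation (ℓ : K) = 1)
    {η : K} (hvη : O.valuation η ≤ 1) (hηℓ : η ^ ℓ = 1) (hη1 : η ≠ 1) :
    O.valuation (η - 1) = 1 := by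
  have hle : O.valuation (η - 1) ≤ 1 := by
    refine le_trans (Valuation.map_sub _ _ _) (max_le hvη ?_)
    rw [map_one]
  rcases hle.lt_or_eq with hlt | heq
  · exfalso
    have hgs : ∑ i ∈ Finset.range ℓ, η ^ i = 0 := by
      have h1 : (η - 1) * ∑ i ∈ Finset.range ℓ, η ^ i = 0 := by
        rw [mul_geom_sum, hηℓ, sub_self]
      exact (mul_eq_zero.mp h1).resolve_left (sub_ne_zero.mpr hη1)
    have hsum : (ℓ : K) = ∑ i ∈ Finset.range ℓ, (1 - η ^ i) := by
      rw [Finset.sum_sub_distrib, hgs, sub_zero, Finset.sum_const, Finset.card_range, nsmul_eq_mul,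
        mul_one]
    have hlt' : ∀ i ∈ Finset.range ℓ, O.valuation (1 - η ^ i) < 1 := by
      intro i _
      have e : 1 - η ^ i = -((η - 1) * ∑ m ∈ Finset.range i, η ^ m) := by
        rw [mul_geom_sum]
        ring
      rw [e, Valuation.map_neg, map_mul]
      have hs : O.valuation (∑ m ∈ Finset.range i, η ^ m) ≤ 1 := by
        refine Valuation.map_sum_le _ (fun m _ => ?_)
        rw [map_pow]
        exact pow_le_one₀ zero_le hvη
      calc O.valuation (η - 1) * O.valuation (∑ m ∈ Finset.range i, η ^ m)
          ≤ O.valuation (η - 1) * 1 := mul_le_mul' le_rfl hs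
        _ < 1 := by rw [mul_one]; exact hlt
    have h : O.valuation (ℓ : K) < 1 := by
      rw [hsum]
      exact Valuation.map_sum_lt _ one_ne_zero hlt'
    exact absurd hvℓ h.ne
  · exact heq

set_option maxHeartbeats 1600000 in
/-- **THE TAME-INERTIAL LAW (kernel, hypothesis-free): equivariant uniformization above a totally tamely ramified
cyclic top COMES DOWN, whatever the residue field.**  Given a model `R ⊆ O`, ENLARGE it downstairs to
`R₁ := R[ζ, (ζ^j - 1)⁻¹ (0 < j < ℓ)] ⊆ O` (`ζ^j - 1 ∈ O×` because `ℓ ∈ O×`: `valuation_sub_one_eq_one`); the cell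
gives a `σ`-stable regular model `R₁[t₀] ⊆ O′`; Cossart–Piltant's toric descent step for models (Literature
`exists_fixed_model_isRegularLocalRing`, whose hypotheses are EXACTLY: base fixed by `σ` and universally catenary,
`ℓ⁻¹, ζ, (ζ^j-1)⁻¹` in the base, `σ` residually trivial on the upstairs local ring, residues algebraic over the base
— no «residues in `k`») yields `σ`-fixed `t ⊆ O′` with `R₁[t]` regular at the centre; fixed elements lie in `K`
(cyclic Galois), pull back and transport as in g25's law. (Sources: CossartPiltant2008, proof of Lemma 9.4 (HAL pp.
28–29); CossartPiltant2019, Prop. 4.10.) -/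
theorem relLU_of_tameInertialLUAbove {O : ValuationSubring K} (h : TameInertialLUAbove k O) :
    RelLocalUniformization k K O := by
  classical
  intro R hRfg hRfrac hRO
  obtain ⟨K', hfin, hgal, σ, hcyc, ℓ, hℓ, hℓk, hσℓ, ζ, hζ, O', hO'O, hσO', hresO, halgO, hLU⟩ := h
  haveI := hfin
  haveI := hgal
  have hfinj : Function.Injective (algebraMap K K' : K →+* K') := (algebraMap K K').injective
  -- (1) membership in `O` and `v < 1` are read upstairs (`O = O′ ∩ K`)
  have hmemO : ∀ x : K, x ∈ O ↔ algebraMap K K' x ∈ O' := fun x => by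
    rw [← hO'O]
    rfl
  have hvalO : ∀ y : K, O.valuation y < 1 ↔ O'.valuation (algebraMap K K' y) < 1 := fun y => by
    rw [← valuation_comap_lt_one_iff O' (algebraMap K K' : K →+* K') y, hO'O]
  -- (2) `σ` fixes `K` and `k`; constants lie in `O`
  have hσf : ∀ x : K, σ (algebraMap K K' x) = algebraMap K K' x := fun x => σ.commutes x
  have hfk : ∀ c : k, algebraMap K K' (algebraMap k K c) = algebraMap k K' c := fun c =>
    (IsScalarTower.algebraMap_apply k K K' c).symm
  have hkO : ∀ c : k, algebraMap k K c ∈ O := fun c => hRO (R.algebraMap_mem c)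
  have hℓ0 : ℓ ≠ 0 := hℓ.ne'
  -- (3) the units `ℓ, ζ, ζ^j - 1` of `O`
  have hℓK : (ℓ : K) = algebraMap k K (ℓ : k) := by rw [map_natCast]
  have hℓne : (ℓ : K) ≠ 0 := by
    rw [hℓK]
    exact (_root_.map_ne_zero _).mpr hℓk
  have hvℓ : O.valuation (ℓ : K) = 1 := by
    have h1 : O.valuation (ℓ : K) ≤ 1 := (O.valuation_le_one_iff _).mpr (by rw [hℓK]; exact hkO _)
    have h2 : O.valuation (ℓ : K)⁻¹ ≤ 1 :=
      (O.valuation_le_one_iff _).mpr (by rw [hℓK, ← map_inv₀]; exact hkO _)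
    have h3 : O.valuation (ℓ : K) * O.valuation (ℓ : K)⁻¹ = 1 := by
      rw [← map_mul, mul_inv_cancel₀ hℓne, map_one]
    refine le_antisymm h1 ?_
    calc (1 : _) = O.valuation (ℓ : K) * O.valuation (ℓ : K)⁻¹ := h3.symm
      _ ≤ O.valuation (ℓ : K) * 1 := mul_le_mul' le_rfl h2
      _ = O.valuation (ℓ : K) := mul_one _
  have hvζ : O.valuation ζ = 1 := by
    have h1 : (O.valuation ζ) ^ ℓ = 1 := by rw [← map_pow, hζ.pow_eq_one, map_one]
    exact (pow_eq_one_iff_left hℓ0).mp h1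
  have hζO : ζ ∈ O := (O.valuation_le_one_iff _).mp hvζ.le
  have hvη : ∀ j : ℕ, 0 < j → j < ℓ → O.valuation (ζ ^ j - 1) = 1 := by
    intro j hj hjℓ
    refine valuation_sub_one_eq_one O hvℓ (by rw [map_pow, hvζ, one_pow]) ?_
      (hζ.pow_ne_one_of_pos_of_lt hj.ne' hjℓ)
    rw [← pow_mul, mul_comm, pow_mul, hζ.pow_eq_one, one_pow]
  have hηne : ∀ j : ℕ, 0 < j → j < ℓ → ζ ^ j - 1 ≠ 0 := fun j hj hjℓ =>
    sub_ne_zero.mpr (hζ.pow_ne_one_of_pos_of_lt hj.ne' hjℓ)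
  -- (4) the ENLARGED model `R₁ = R[ζ, (ζ^j - 1)⁻¹] ⊆ O` downstairs
  obtain ⟨s₀, hs₀⟩ := hRfg
  let z₀ : Finset K := insert ζ ((Finset.Ioo 0 ℓ).image fun j => (ζ ^ j - 1)⁻¹)
  let R₁ : Subalgebra k K := Algebra.adjoin k ((s₀ : Set K) ∪ (z₀ : Set K))
  have hRR₁ : R ≤ R₁ := by
    rw [← hs₀]
    exact Algebra.adjoin_mono Set.subset_union_left
  have hR₁fg : R₁.FG := ⟨s₀ ∪ z₀, by rw [Finset.coe_union]⟩
  have hR₁frac : IsFractionRing R₁ K := LogCanQuotLU.Negative.isFractionRing_of_le hRR₁ hRfrac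
  have hz₀O : ∀ z ∈ z₀, z ∈ O := by
    intro z hz
    rcases Finset.mem_insert.mp hz with rfl | hz
    · exact hζO
    · obtain ⟨j, hj, rfl⟩ := Finset.mem_image.mp hz
      obtain ⟨hj0, hjℓ⟩ := Finset.mem_Ioo.mp hj
      rw [← O.valuation_le_one_iff, map_inv₀, hvη j hj0 hjℓ, inv_one]
  have hs₀R : ∀ x ∈ (s₀ : Set K), x ∈ R := fun x hx => by
    rw [← hs₀]
    exact Algebra.subset_adjoin hx
  have hR₁cl : R₁.toSubring = Subring.closure (Set.range (algebraMap k K) ∪ ((s₀ : Set K) ∪ (z₀ : Set K))) :=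
    Algebra.adjoin_eq_ring_closure _
  have hR₁O : R₁.toSubring ≤ O.toSubring := by
    rw [hR₁cl]
    refine Subring.closure_le.mpr ?_
    rintro x (⟨c, rfl⟩ | hx | hx)
    · exact hkO c
    · exact hRO (hs₀R x hx)
    · exact hz₀O x hx
  have hζR₁ : ζ ∈ R₁ := Algebra.subset_adjoin (Or.inr (Finset.mem_insert_self _ _))
  have hηR₁ : ∀ j : ℕ, 0 < j → j < ℓ → (ζ ^ j - 1)⁻¹ ∈ R₁ := fun j hj hjℓ =>
    Algebra.subset_adjoin (Or.inr (Finset.mem_insert_of_mem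
      (Finset.mem_image.mpr ⟨j, Finset.mem_Ioo.mpr ⟨hj, hjℓ⟩, rfl⟩)))
  -- (5) the cell's clause for `R₁`
  obtain ⟨t₀, hT₀O, hσT₀, hreg⟩ := hLU R₁ hR₁fg hR₁frac hR₁O
  haveI := hreg
  -- (6) the base `S = R₁` read in `K′`
  have hRS : ∀ x ∈ R₁, algebraMap K K' x ∈ R₁.toSubring.map (algebraMap K K' : K →+* K') :=
    fun x hx => Subring.mem_map.mpr ⟨x, hx, rfl⟩
  have hσS : ∀ s ∈ R₁.toSubring.map (algebraMap K K' : K →+* K'), (σ : K' ≃+* K') s = s := by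
    intro s hs
    obtain ⟨x, -, rfl⟩ := Subring.mem_map.mp hs
    exact hσf x
  haveI : Algebra.FiniteType k R₁ := (Subalgebra.fg_iff_finiteType R₁).mp hR₁fg
  have hSuc : IsUniversallyCatenaryRing (R₁.toSubring.map (algebraMap K K' : K →+* K')) :=
    (isUniversallyCatenaryRing_of_finiteType_field k R₁).of_surjective
      ((algebraMap K K' : K →+* K').restrict R₁ (R₁.toSubring.map (algebraMap K K' : K →+* K')) hRS) (by
        rintro ⟨y, hy⟩
        obtain ⟨x, hx, rfl⟩ := Subring.mem_map.mp hy
        exact ⟨⟨x, hx⟩, rfl⟩)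
  have hkS : ∀ c : k, algebraMap k K' c ∈ R₁.toSubring.map (algebraMap K K' : K →+* K') := fun c => by
    rw [← hfk]
    exact hRS _ (R₁.algebraMap_mem c)
  let ψ : k →+* R₁.toSubring.map (algebraMap K K' : K →+* K') := (algebraMap k K').codRestrict _ hkS
  have hℓu : IsUnit ((ℓ : R₁.toSubring.map (algebraMap K K' : K →+* K'))) := by
    rw [← map_natCast ψ ℓ]
    exact (IsUnit.mk0 _ hℓk).map ψ
  have hζS : algebraMap K K' ζ ∈ R₁.toSubring.map (algebraMap K K' : K →+* K') := hRS ζ hζR₁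
  have hζℓ : (algebraMap K K' ζ) ^ ℓ = 1 := by
    rw [← map_pow, hζ.pow_eq_one, map_one]
  have hζu : ∀ j : ℕ, 0 < j → j < ℓ →
      IsUnit ((⟨algebraMap K K' ζ, hζS⟩ : R₁.toSubring.map (algebraMap K K' : K →+* K')) ^ j - 1) := by
    intro j hj hjℓ
    have hw : ((algebraMap K K' ζ) ^ j - 1) * algebraMap K K' ((ζ ^ j - 1)⁻¹) = 1 := by
      rw [← map_pow, ← map_one (algebraMap K K' : K →+* K'), ← map_sub, ← map_mul,
        mul_inv_cancel₀ (hηne j hj hjℓ)]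
    refine IsUnit.of_mul_eq_one ⟨algebraMap K K' ((ζ ^ j - 1)⁻¹), hRS _ (hηR₁ j hj hjℓ)⟩
      (Subtype.ext ?_)
    show ((algebraMap K K' ζ) ^ j - 1) * algebraMap K K' ((ζ ^ j - 1)⁻¹) = 1
    exact hw
  -- (7) `σ` fixes `O′`, is residually trivial, and `κ(O′)` is algebraic over the base
  have hσO'' : ∀ x ∈ O', (σ : K' ≃+* K') x ∈ O' := fun x hx => (hσO' x).mp hx
  have hres : ∀ b ∈ locAtCentre (modelAbove k R₁ K' t₀) O', O'.valuation ((σ : K' ≃+* K') b - b) < 1 :=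
    fun b hb => hresO b (locAtCentre_le hT₀O hb)
  have hcomp : (algebraMap (R₁.toSubring.map (algebraMap K K' : K →+* K')) K').comp ψ = algebraMap k K' :=
    RingHom.ext fun _ => rfl
  have halg : ∀ z : O', ∃ q : Polynomial (R₁.toSubring.map (algebraMap K K' : K →+* K')),
      (∃ i, IsUnit (q.coeff i)) ∧ O'.valuation (Polynomial.aeval (z : K') q) < 1 := by
    intro z
    obtain ⟨f, hf0, hfz⟩ := halgO z z.2
    refine ⟨f.map ψ, ⟨f.natDegree, ?_⟩, ?_⟩
    · rw [coeff_map]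
      exact (IsUnit.mk0 _ (leadingCoeff_ne_zero.mpr hf0)).map ψ
    · have hq : Polynomial.aeval (z : K') (f.map ψ) = Polynomial.aeval (z : K') f := by
        rw [aeval_def, eval₂_map, hcomp, ← aeval_def]
      rw [hq]
      exact (O'.mem_nonunits_iff).mp hfz
  -- (8) Cossart–Piltant's toric descent step for models
  obtain ⟨t, hσt, hTO, hTreg⟩ := exists_fixed_model_isRegularLocalRing O' (σ : K' ≃+* K') hσO''
    (R₁.toSubring.map (algebraMap K K' : K →+* K')) hσS hSuc t₀ hT₀O hσT₀ hreg
    (IsRegularLocalRing.spanFinrank_maximalIdeal (R := locAtCentre (modelAbove k R₁ K' t₀) O')).symm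
    hres halg hℓ0 (toRingEquiv_pow_eq_one hσℓ) hℓu (algebraMap K K' ζ) hζS hζℓ hζu
  -- (9) the fixed generators lie in `K`: pull the model back to `K`
  have ht_sub : (t : Set K') ⊆ Set.range (algebraMap K K' : K →+* K') := fun z hz =>
    exists_algebraMap_eq_of_fixed hcyc (hσt z hz)
  let tK : Finset K := t.preimage (algebraMap K K') (hfinj.injOn)
  have hftK : (algebraMap K K' : K →+* K') '' (tK : Set K) = (t : Set K') := by
    rw [Finset.coe_preimage]
    exact Set.image_preimage_eq_of_subset ht_sub
  let A₀ : Subalgebra k K := Algebra.adjoin k (((s₀ : Set K) ∪ (z₀ : Set K)) ∪ (tK : Set K))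
  have hR₁A₀ : R₁ ≤ A₀ := Algebra.adjoin_mono Set.subset_union_left
  have hRA₀ : R ≤ A₀ := hRR₁.trans hR₁A₀
  have hA₀fg : A₀.FG := ⟨(s₀ ∪ z₀) ∪ tK, by rw [Finset.coe_union, Finset.coe_union]⟩
  have hA₀cl : A₀.toSubring =
      Subring.closure (Set.range (algebraMap k K) ∪ (((s₀ : Set K) ∪ (z₀ : Set K)) ∪ (tK : Set K))) :=
    Algebra.adjoin_eq_ring_closure _
  have hT : A₀.toSubring.map (algebraMap K K' : K →+* K') =
      Subring.closure (((R₁.toSubring.map (algebraMap K K' : K →+* K')) : Set K') ∪ (t : Set K')) := by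
    have e1 : ((R₁.toSubring.map (algebraMap K K' : K →+* K') : Subring K') : Set K') =
        (Subring.closure ((algebraMap K K' : K →+* K') ''
          (Set.range (algebraMap k K) ∪ ((s₀ : Set K) ∪ (z₀ : Set K)))) : Set K') := by
      rw [hR₁cl, RingHom.map_closure]
    rw [hA₀cl, RingHom.map_closure, e1, Subring.closure_union, Subring.closure_eq, ← Subring.closure_union]
    simp only [Set.image_union, hftK, Set.union_assoc]
  have hA₀O : A₀.toSubring ≤ O.toSubring := by
    intro x hx
    have hfx : algebraMap K K' x ∈ A₀.toSubring.map (algebraMap K K' : K →+* K') :=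
      Subring.mem_map.mpr ⟨x, hx, rfl⟩
    rw [hT] at hfx
    exact (hmemO x).mpr (hTO hfx)
  refine ⟨A₀, hA₀O, hRA₀, hA₀fg, ?_⟩
  -- (10) transport of the local ring at the centre along `K ↪ K′`
  let g : A₀.toSubring ≃+*
      Subring.closure (((R₁.toSubring.map (algebraMap K K' : K →+* K')) : Set K') ∪ (t : Set K')) :=
    (A₀.toSubring.equivMapOfInjective (algebraMap K K' : K →+* K') hfinj).trans (RingEquiv.subringCongr hT)
  have hg : ∀ x : A₀.toSubring, ((g x : Subring.closure (((R₁.toSubring.map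
      (algebraMap K K' : K →+* K')) : Set K') ∪ (t : Set K'))) : K') = algebraMap K K' x := fun _ => rfl
  set P : Ideal A₀.toSubring := Ideal.comap (Subring.inclusion hA₀O) (IsLocalRing.maximalIdeal O) with hP
  set P' := subringCentre (Subring.closure (((R₁.toSubring.map (algebraMap K K' : K →+* K')) : Set K') ∪
    (t : Set K'))) O' hTO with hP'
  haveI hregP' : IsRegularLocalRing (Localization.AtPrime P') :=
    (isRegularLocalRing_locAtCentre_iff hTO).mp hTreg
  have hPP' : P = P'.comap g.toRingHom := by
    ext x
    simp only [hP, hP', Ideal.mem_comap, RingEquiv.toRingHom_eq_coe, RingHom.coe_coe,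
      mem_subringCentre_iff]
    rw [ValuationSubring.valuation_lt_one_iff, hg]
    exact hvalO x
  have hmap : Submonoid.map g.toRingHom.toMonoidHom P.primeCompl = P'.primeCompl := by
    ext y
    constructor
    · rintro ⟨x, hx, rfl⟩
      change g x ∉ P'
      have hx' : x ∉ P := hx
      rw [hPP', Ideal.mem_comap] at hx'
      exact hx'
    · intro hy
      have hy' : y ∉ P' := hy
      refine ⟨g.symm y, ?_, ?_⟩
      · change g.symm y ∉ P
        rw [hPP', Ideal.mem_comap]
        change ¬ g (g.symm y) ∈ P'
        rw [g.apply_symm_apply]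
        exact hy'
      · change g (g.symm y) = y
        exact g.apply_symm_apply y
  exact IsRegularLocalRing.of_ringEquiv (R := Localization.AtPrime P')
    (IsLocalization.ringEquivOfRingEquiv (Localization.AtPrime P) (Localization.AtPrime P') g hmap).symm

end LawT

end Summit.ResolutionOfSingularities.ResolutionOfSingularities.Theorems.TameInertialLU

end
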